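import Summits.BirchSwinnertonDyer.BirchSwinnertonDyer.Theorems.ManinLocalTwoThreeHeisenbergLiftFiveLe
import HarnessLib

/-!
# The HEISENBERG LIFT mod `p ≥ 5` on ANY subgroup of `SL₂(ℤ)` missing `−1` — input of the depth-`p³` step of the prime-generic tower
# (route `ManinLocalTwoThree`, cell bsd-f2-manin; the LEAD's law `ShiftEqualiser.PrimeShiftInvariantIsDiamond`, T-p1-g11-2;
# prover seat p3 gen 11)

p2 g12's `HeisenbergFiveLe.exists_heisenbergLift_of_five_le` gives, for every prime `p ≥ 5`, every level `M` and all additive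
`β, λ : Γ₀(M) → ℤ/p`, a function `μ` with `μ(γγ′) = μγ + μγ′ + βγ·λγ′`.  At `p ≥ 5` the natural «`b`-coordinate» and
«`c`-coordinate» of the shift descent are NOT additive on `Γ₀(M)` (the Borel of `SL₂(𝔽_p)` has `U ⊆ [B, B]`), only on the
index-`(p−1)` subgroup `G₁ = Γ₀(M) ∩ Γ₁(p)`; so the depth-`p³` step needs the lift ON `G₁`.  This file repeats p2's §3 + §5 for an
ARBITRARY group `Γ` with an injective homomorphism `j : Γ → SL₂(ℤ)` whose image misses `−1`:
**`exists_kernel_free_presentation_of_injective`** (a subgroup `H ≤ Γ` of index `∣ 6` with `e : F → Γ`, `ρ : H → F`, `F` free,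
`j h = j(e(ρ h))` or `j h = −1·j(e(ρ h))`) and **`exists_heisenbergLift_of_five_le'`** (the lift on `Γ`, `p ≥ 5`, when no element
of `Γ` maps to `−1`).  The kernel-of-abelianisation freeness, the free-group lift and Gaschütz averaging are p2's, imported.
HONEST FRAMING: group theory only; nothing about BSD, Manin's conjecture, C2/C3 or the LEAD's law is asserted.
[cite: SerreTrees, §I.4 Thm 7; §I.5 Thm 8] [cite: DarmonDiamondTaylor1995, Lemma 4.28 (p. 135)]
-/

set_option linter.dupNamespace false

noncomputable section

open scoped MatrixGroups
open CongruenceSubgroup Monoid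
open Literature.GroupTheory.SpecificGroups.ModularGroupFreeProduct
open Literature.GroupTheory.CombinatorialGroupTheory

namespace Summit.BirchSwinnertonDyer.BirchSwinnertonDyer.Theorems.ManinLocalTwoThree

namespace PrimeShift

open HeisenbergFiveLe (exists_abelianisation ofCoprodI_injective exists_heisenberg_on_free)

/-- **A subgroup of index `∣ 6` with a free presentation modulo `±1`**, for ANY group `Γ` with an injective homomorphism
`j : Γ → SL₂(ℤ)`: homomorphisms `e : F → Γ` (`F` free) and `ρ : H → F` with `j h = j(e(ρ h))` or `j h = −1 · j(e(ρ h))` on `H`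
(`H` = kernel of `Γ → SL₂(ℤ) → ℤ/2 ∗ ℤ/3 → ℤ/2 × ℤ/3`; p2's `exists_kernel_free_presentation` is the case `Γ = Γ₀(M)`). [folklore] -/
theorem exists_kernel_free_presentation_of_injective {Γ : Type} [Group Γ] (j : Γ →* SL(2, ℤ)) :
    ∃ (H : Subgroup Γ) (ι : Type) (e : FreeGroup ι →* Γ) (ρ : H →* FreeGroup ι),
      H.index ∣ 6 ∧ ∀ h : H, j (h : Γ) = j (e (ρ h)) ∨ j (h : Γ) = -1 * j (e (ρ h)) := by
  classical
  let φ : ∀ b : Bool, PUnit.{1} →* Fac b := fun _ => 1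
  obtain ⟨abP, hfree⟩ := exists_abelianisation φ
  let π : Γ →* PushoutI φ := ((PushoutI.ofCoprodI (φ := φ)).comp fromSL).comp j
  have hπ : ∀ g : Γ, π g = PushoutI.ofCoprodI (fromSL (j g)) := fun g => rfl
  let χ : Γ →* Multiplicative (ZMod 2) × Multiplicative (ZMod 3) := abP.comp π
  let H : Subgroup Γ := χ.ker
  let S : Subgroup (PushoutI φ) := H.map π
  have hS : S ≤ abP.ker := by
    rintro _ ⟨h, hh, rfl⟩
    exact hh
  haveI : IsFreeGroup S := hfree S hS
  let πS : H →* S := (π.comp H.subtype).codRestrict S fun h => ⟨(h : Γ), h.2, rfl⟩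
  have hsurj : Function.Surjective πS := by
    rintro ⟨_, h, hh, rfl⟩
    exact ⟨⟨h, hh⟩, rfl⟩
  choose sec hsec using fun x : IsFreeGroup.Generators S => hsurj (IsFreeGroup.of x)
  let e : FreeGroup (IsFreeGroup.Generators S) →* Γ := H.subtype.comp (FreeGroup.lift sec)
  let ρ : H →* FreeGroup (IsFreeGroup.Generators S) := (IsFreeGroup.mulEquiv S).symm.toMonoidHom.comp πS
  have hcomp : ∀ w, πS (FreeGroup.lift sec w) = IsFreeGroup.mulEquiv S w := by
    intro w
    have h : πS.comp (FreeGroup.lift sec) = (IsFreeGroup.mulEquiv S).toMonoidHom := by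
      refine FreeGroup.ext_hom _ _ fun x => ?_
      rw [MonoidHom.comp_apply, MulEquiv.coe_toMonoidHom]
      show πS (FreeGroup.lift sec (FreeGroup.of x)) = _
      rw [FreeGroup.lift_apply_of, hsec]
      rfl
    rw [← MonoidHom.comp_apply, h]
    rfl
  refine ⟨H, _, e, ρ, ?_, fun h => ?_⟩
  · show χ.ker.index ∣ 6
    rw [Subgroup.index_ker]
    have h1 := Subgroup.card_subgroup_dvd_card χ.range
    have hA : Nat.card (Multiplicative (ZMod 2) × Multiplicative (ZMod 3)) = 6 := by
      rw [Nat.card_prod]; simp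
    rwa [hA] at h1
  · have h1 : πS (FreeGroup.lift sec (ρ h)) = πS h := by
      rw [hcomp]
      exact (IsFreeGroup.mulEquiv S).apply_symm_apply _
    have h2 : π (e (ρ h)) = π (h : Γ) := by
      have := congrArg (fun s : S => (s : PushoutI φ)) h1
      exact this
    have h3 : fromSL (j (h : Γ) * (j (e (ρ h)))⁻¹) = 1 := by
      apply ofCoprodI_injective φ
      rw [map_mul, map_inv, map_one, map_mul, map_inv, ← hπ, ← hπ, h2, mul_inv_cancel]
    rcases Literature.NumberTheory.ModularForms.Gamma0Free.eq_one_or_eq_neg_one_of_fromSL_eq_one h3 with h4 | h4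
    · left
      exact mul_inv_eq_one.mp h4
    · right
      exact mul_inv_eq_iff_eq_mul.mp h4

/-- **THE HEISENBERG LIFT mod `p ≥ 5` on a subgroup of `SL₂(ℤ)` missing `−1`.**  For a group `Γ` with an injective
`j : Γ → SL₂(ℤ)`, `−1 ∉ j(Γ)`, a prime `p ≥ 5` and additive `β, λ : Γ → ℤ/p` there is `μ : Γ → ℤ/p` with
`μ(γγ′) = μγ + μγ′ + βγ·λγ′` (on the index-`∣ 6` subgroup `H` it is the free-group lift `ζ ∘ ρ`, and Gaschütz averaging extends
it since `6` is invertible mod `p`). [folklore; cf. Brown, *Cohomology of Groups*, III.9–10] -/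
theorem exists_heisenbergLift_of_five_le' {p : ℕ} [Fact p.Prime] (hp5 : 5 ≤ p) {Γ : Type} [Group Γ]
    (j : Γ →* SL(2, ℤ)) (hj : Function.Injective j) (hneg : ∀ g : Γ, j g ≠ -1) (β lam : Γ → ZMod p)
    (hβ : ∀ x y : Γ, β (x * y) = β x + β y) (hlam : ∀ x y : Γ, lam (x * y) = lam x + lam y) :
    ∃ μ : Γ → ZMod p, ∀ γ γ' : Γ, μ (γ * γ') = μ γ + μ γ' + β γ * lam γ' := by
  classical
  obtain ⟨H, ι, e, ρ, hidx, hdec⟩ := exists_kernel_free_presentation_of_injective j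
  obtain ⟨ζ, hζ⟩ := exists_heisenberg_on_free e β lam hβ hlam
  -- on `H`, `h = e(ρ h)` exactly (the other sign would put `−1` in `j(Γ)`)
  have hdec' : ∀ h : H, (h : Γ) = e (ρ h) := by
    intro h
    rcases hdec h with h1 | h1
    · exact hj h1
    · exfalso
      apply hneg ((h : Γ) * (e (ρ h))⁻¹)
      rw [map_mul, map_inv, h1, mul_inv_cancel_right]
  let μ₀ : Γ → ZMod p := fun g => if hg : g ∈ H then ζ (ρ ⟨g, hg⟩) else 0
  have hμ₀ : ∀ h ∈ H, ∀ k ∈ H, μ₀ (h * k) = μ₀ h + μ₀ k + β h * lam k := by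
    intro h hh k hk
    have hhk : h * k ∈ H := H.mul_mem hh hk
    simp only [μ₀, dif_pos hh, dif_pos hk, dif_pos hhk]
    have hmul : ρ ⟨h * k, hhk⟩ = ρ ⟨h, hh⟩ * ρ ⟨k, hk⟩ := by rw [← map_mul]; rfl
    rw [hmul, hζ, ← hdec' ⟨h, hh⟩, ← hdec' ⟨k, hk⟩]
  have hidx0 : H.index ≠ 0 := fun h0 => by rw [h0] at hidx; norm_num at hidx
  haveI : H.FiniteIndex := ⟨hidx0⟩
  have hunit : IsUnit ((H.index : ℕ) : ZMod p) := by
    rw [isUnit_iff_ne_zero, ne_eq, ZMod.natCast_eq_zero_iff]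
    intro hpd
    have hp6 : p ∣ 2 * 3 := dvd_trans hpd hidx
    rcases (Nat.Prime.dvd_mul (Fact.out : p.Prime)).mp hp6 with h | h
    · have := Nat.le_of_dvd (by norm_num) h; omega
    · have := Nat.le_of_dvd (by norm_num) h; omega
  exact exists_coboundary_of_coboundary_on_finiteIndex H hunit (fun x y => β x * lam y)
    (Gaschuetz.twoCocycle_mul hβ hlam) μ₀ hμ₀

end PrimeShift

end Summit.BirchSwinnertonDyer.BirchSwinnertonDyer.Theorems.ManinLocalTwoThree

end
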